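import Mathlib.Analysis.Fourier.AddCircle
import Mathlib.Algebra.Order.ToIntervalMod
import Mathlib.Analysis.Asymptotics.Lemmas
import HarnessLib

/-!
# Weyl's criterion on the circle: from Weyl sums to counting points in arcs

Topic `Literature/NumberTheory/DiophantineApproximation` (next to `KroneckerWeyl.lean`).  Everything
here is PROVED; no named facts.

Let `S_N` be a sequence of finite families of points (a type `X`, finsets `S N`, an angle map
`ω : X → ℝ`) with `#S_N → ∞`, and suppose the **Weyl sums** are small:

  `∑_{x ∈ S_N} e^{i k ω(x)} = o(#S_N)`  for every integer `k ≠ 0`.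

Then the angles are equidistributed modulo `2π` in the sense of ARCS: for every `β` and every
`0 < α ≤ 2π`,

  `#{x ∈ S_N : ω(x) mod 2π ∈ [β, β + α)} / #S_N → α / (2π)`

(`Literature.NumberTheory.DiophantineApproximation.WeylCircle.tendsto_card_arc_div`), membership
in the half-open arc being `toIcoMod 2π β (ω x) < β + α` (the representative of `ω x` in
`[β, β + 2π)`).  This is Weyl's theorem (H. Weyl, *Über die Gleichverteilung von Zahlen mod. Eins*,
Math. Ann. 77 (1916), §1, Satz 1 with §2: the criterion) in the form used for prime angles
(Hecke 1920, §7, via "das bekannte Weylsche Kriterium").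

## Proof (elementary, no measure theory)

1. For trigonometric polynomials `P(t) = ∑_k c_k e^{ikt}` the averages over `S_N` of `P(ω - t₀)`
   tend to `c_0` (`tendsto_avg_trigPoly`).
2. Every continuous `2π`-periodic function is a uniform limit of trigonometric polynomials
   (Mathlib's `span_fourier_closure_eq_top` on `C(AddCircle (2π), ℂ)`, transferred to `ℝ`:
   `exists_trigPoly_approx`).
3. For the periodic "tent" `g_K(t) = max(0, 1 - K‖t‖/(2π))` (`‖t‖` = distance to `2πℤ`) and its
   rotates by `2πj/K`, which form a PARTITION OF UNITY (`sum_tentCircle_eq_one`), 1.–2. give that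
   all rotates have asymptotic average `1/K` (`tendsto_avg_tentCircle`): the unknown common value
   `γ` of the approximating polynomial must satisfy `K γ ≈ 1`.
4. The indicator of `[β, β + α)` is sandwiched between sums of `≈ αK/2π ∓ 2` consecutive tents
   (`sum_tent_le_indicator`, `indicator_le_sum_tent`), whence the claim as `K → ∞`.

## References

* H. Weyl, *Über die Gleichverteilung von Zahlen mod. Eins*, Math. Ann. 77 (1916), 313–352, §§1–2.
  [Weyl1916]
* E. Hecke, *Eine neue Art von Zetafunktionen und ihre Beziehungen zur Verteilung der
  Primzahlen. II*, Math. Z. 6 (1920), 11–51, §7. [HeckeMathZ1920]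
-/

noncomputable section

open Complex Filter Topology Asymptotics Finset

namespace Literature.NumberTheory.DiophantineApproximation

namespace WeylCircle

/-- `0 < 2π` as a `Fact`, for the `AddCircle (2π)` API (local instance only). [folklore] -/
theorem fact_two_pi_pos : Fact (0 < 2 * Real.pi) := ⟨Real.two_pi_pos⟩

attribute [local instance] fact_two_pi_pos

variable {X : Type*}

/-! ### 1. Averages of trigonometric polynomials -/

/-- **Weyl sums control trigonometric polynomials**: if `∑_{x ∈ S_N} e^{ikω(x)} = o(#S_N)` for all
`k ≠ 0` and `#S_N → ∞`, then for `P(t) = ∑_{k ∈ s} c_k e^{ikt}` and any shift `t₀`,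
`(#S_N)⁻¹ ∑_{x ∈ S_N} P(ω(x) - t₀) → c_0` (or `0` if `0 ∉ s`). [cite: Weyl1916, §1] -/
theorem tendsto_avg_trigPoly (S : ℕ → Finset X) (ω : X → ℝ)
    (h0 : Tendsto (fun N ↦ (S N).card) atTop atTop)
    (hW : ∀ k : ℤ, k ≠ 0 →
      (fun N ↦ ∑ x ∈ S N, cexp (k * ω x * I)) =o[atTop] fun N ↦ ((S N).card : ℝ))
    (s : Finset ℤ) (c : ℤ → ℂ) (t₀ : ℝ) :
    Tendsto (fun N ↦ (∑ x ∈ S N, ∑ k ∈ s, c k * cexp (k * (ω x - t₀) * I)) / (S N).card) atTop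
      (𝓝 (if (0 : ℤ) ∈ s then c 0 else 0)) := by
  -- rewrite as a finite sum over `k` of `c_k e^{-ikt₀} · (Weyl sum)/(#S)`
  have hswap : ∀ N, (∑ x ∈ S N, ∑ k ∈ s, c k * cexp (k * (ω x - t₀) * I)) / (S N).card =
      ∑ k ∈ s, c k * cexp (-(k * t₀ * I)) * ((∑ x ∈ S N, cexp (k * ω x * I)) / (S N).card) := by
    intro N
    rw [sum_comm, sum_div]
    refine sum_congr rfl fun k _ ↦ ?_
    rw [mul_div_assoc', mul_sum]
    congr 1
    refine sum_congr rfl fun x _ ↦ ?_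
    rw [mul_assoc (c k), ← Complex.exp_add]
    congr 2
    ring
  simp_rw [hswap]
  have hlim : ∀ k ∈ s, Tendsto (fun N ↦ c k * cexp (-(k * t₀ * I)) *
      ((∑ x ∈ S N, cexp (k * ω x * I)) / (S N).card)) atTop
      (𝓝 (if k = 0 then c 0 else 0)) := by
    intro k _
    rcases eq_or_ne k 0 with rfl | hk
    · simp only [Int.cast_zero, zero_mul, Complex.exp_zero, sum_const, nsmul_eq_mul, mul_one,
        neg_zero, if_true]
      have hev : ∀ᶠ N in atTop, ((S N).card : ℂ) / (S N).card = 1 := by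
        filter_upwards [h0.eventually_ge_atTop 1] with N hN
        exact div_self (by exact_mod_cast (by omega : (S N).card ≠ 0))
      exact (tendsto_const_nhds.congr' (hev.mono fun N hN ↦ by rw [hN, mul_one])).congr
        (fun N ↦ rfl)
    · rw [if_neg hk]
      have h1 : (fun N ↦ ∑ x ∈ S N, cexp (k * ω x * I)) =o[atTop] fun N ↦ ((S N).card : ℂ) :=
        (hW k hk).trans_isBigO (IsBigO.of_bound 1 (Eventually.of_forall fun N ↦ by
          rw [Real.norm_natCast, Complex.norm_natCast, one_mul]))
      have h' : Tendsto (fun N ↦ (∑ x ∈ S N, cexp (k * ω x * I)) / ((S N).card : ℂ)) atTop (𝓝 0) :=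
        h1.tendsto_div_nhds_zero
      simpa using h'.const_mul (c k * cexp (-(k * t₀ * I)))
  have := tendsto_finsetSum s hlim
  simpa only [sum_ite_eq', ite_smul] using this

/-! ### 2. Uniform approximation of continuous periodic functions by trigonometric polynomials -/

/-- **Weierstrass on the circle, transferred to `ℝ`**: every continuous function on
`AddCircle (2π)` is, as a `2π`-periodic function on `ℝ`, a uniform limit of trigonometric
polynomials `∑_k c_k e^{ikt}` (Mathlib's `span_fourier_closure_eq_top`). [folklore] -/
theorem exists_trigPoly_approx (G : C(AddCircle (2 * Real.pi), ℂ)) {ε : ℝ} (hε : 0 < ε) :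
    ∃ (s : Finset ℤ) (c : ℤ → ℂ),
      ∀ t : ℝ, ‖G (t : AddCircle (2 * Real.pi)) - ∑ k ∈ s, c k * cexp (k * t * I)‖ ≤ ε := by
  have hG : G ∈ (Submodule.span ℂ (Set.range (fourier (T := 2 * Real.pi)))).topologicalClosure := by
    rw [span_fourier_closure_eq_top]; trivial
  have hG' : G ∈ closure ((Submodule.span ℂ (Set.range (fourier (T := 2 * Real.pi))) :
      Submodule ℂ C(AddCircle (2 * Real.pi), ℂ)) : Set C(AddCircle (2 * Real.pi), ℂ)) := by
    rw [← Submodule.topologicalClosure_coe]; exact hG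
  rw [Metric.mem_closure_iff] at hG'
  obtain ⟨P, hP, hdist⟩ := hG' ε hε
  obtain ⟨l, rfl⟩ := Finsupp.mem_span_range_iff_exists_finsupp.mp hP
  refine ⟨l.support, l, fun t ↦ ?_⟩
  have hpt := ContinuousMap.norm_coe_le_norm (G - l.sum fun i a ↦ a • fourier i) (t : AddCircle (2 * Real.pi))
  rw [dist_eq_norm] at hdist
  refine le_trans (le_of_eq ?_) (hpt.trans hdist.le)
  congr 1
  rw [ContinuousMap.sub_apply]
  congr 1
  rw [Finsupp.sum, ContinuousMap.coe_sum, Finset.sum_apply]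
  refine sum_congr rfl fun k _ ↦ ?_
  rw [ContinuousMap.coe_smul, Pi.smul_apply, smul_eq_mul, fourier_coe_apply]
  congr 1
  congr 1
  have hπ : (Real.pi : ℂ) ≠ 0 := ofReal_ne_zero.mpr Real.pi_ne_zero
  field_simp
  push_cast
  ring

/-! ### 3. Tents: the planar partition of unity and the periodic tent -/

/-- The unit tent `Λ(u) = max(0, 1 - |u|)`. [folklore] -/
def tent (u : ℝ) : ℝ := max 0 (1 - |u|)

/-- `0 ≤ Λ ≤ 1`. [folklore] -/
theorem tent_nonneg (u : ℝ) : 0 ≤ tent u := le_max_left _ _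

/-- `Λ(u) = 0` for `|u| ≥ 1`. [folklore] -/
theorem tent_eq_zero {u : ℝ} (hu : 1 ≤ |u|) : tent u = 0 :=
  max_eq_left (by linarith)

/-- `Λ(u) = 1 - |u|` for `|u| ≤ 1`. [folklore] -/
theorem tent_eq {u : ℝ} (hu : |u| ≤ 1) : tent u = 1 - |u| :=
  max_eq_right (by linarith)

/-- `Λ` is even. [folklore] -/
theorem tent_neg (u : ℝ) : tent (-u) = tent u := by rw [tent, tent, abs_neg]

/-- **The integer translates of the tent form a partition of unity**: for `0 ≤ u ≤ K`,
`∑_{j=0}^{K} Λ(u - j) = 1`. [folklore] -/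
theorem sum_tent_sub_eq_one {K : ℕ} {u : ℝ} (hu0 : 0 ≤ u) (huK : u ≤ K) :
    ∑ j ∈ range (K + 1), tent (u - j) = 1 := by
  set j₀ : ℕ := ⌊u⌋₊ with hj₀
  have hfl : (j₀ : ℝ) ≤ u := Nat.floor_le hu0
  have hlt : u < j₀ + 1 := Nat.lt_floor_add_one u
  have hj₀K : j₀ ≤ K := Nat.floor_le_of_le huK
  rw [sum_eq_add j₀ (j₀ + 1) (by omega)]
  · push_cast
    rw [tent_eq (by rw [abs_le]; constructor <;> linarith), abs_of_nonneg (by linarith)]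
    rcases eq_or_lt_of_le hj₀K with h | h
    · -- `j₀ = K`, so `u = K` and the neighbouring tent vanishes
      have hu : u = K := le_antisymm huK (h ▸ hfl)
      rw [tent_eq_zero (by rw [hu, h]; ring_nf; norm_num), hu, h]
      ring
    · rw [tent_eq (by rw [abs_le]; constructor <;> linarith), abs_of_nonpos (by linarith)]
      ring
  · intro j _ hne
    apply tent_eq_zero
    rw [le_abs]
    rcases lt_or_gt_of_ne hne.1 with h1 | h1
    · left
      have : (j : ℝ) + 1 ≤ j₀ := by exact_mod_cast h1
      linarith
    · right
      have h2 : j₀ + 1 < j := lt_of_le_of_ne h1 (Ne.symm hne.2)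
      have : (j₀ : ℝ) + 2 ≤ j := by exact_mod_cast h2
      linarith
  · intro h
    exfalso
    exact h (mem_range.mpr (by omega))
  · intro h
    have hK : j₀ = K := by
      have := mt mem_range.mpr h
      omega
    have hu : u = K := le_antisymm huK (hK ▸ hfl)
    apply tent_eq_zero
    push_cast
    rw [hu, hK]
    ring_nf
    norm_num

/-- The periodic tent of half-width `2π/K`: `g_K(t) = max(0, 1 - K ‖t‖ / (2π))`, `‖t‖` the distance
from `t` to `2πℤ` (the norm of `AddCircle (2π)`). [folklore] -/
def tentCircle (K : ℕ) (t : ℝ) : ℝ := tent (K * ‖((t : ℝ) : AddCircle (2 * Real.pi))‖ / (2 * Real.pi))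

/-- `g_K` as a continuous complex-valued function on the circle. [folklore] -/
def tentCircleMap (K : ℕ) : C(AddCircle (2 * Real.pi), ℂ) where
  toFun x := ((tent (K * ‖x‖ / (2 * Real.pi)) : ℝ) : ℂ)
  continuous_toFun := by
    refine continuous_ofReal.comp ?_
    unfold tent
    fun_prop

/-- `tentCircleMap K (t : AddCircle) = g_K(t)`. [folklore] -/
theorem tentCircleMap_coe (K : ℕ) (t : ℝ) :
    tentCircleMap K (t : AddCircle (2 * Real.pi)) = (tentCircle K t : ℂ) := rfl

/-- `g_K` is `2π`-periodic (indeed it factors through the circle): `g_K(t) = g_K(t')` whenever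
`t ≡ t' (mod 2π)`. [folklore] -/
theorem tentCircle_eq_of_coe_eq (K : ℕ) {t t' : ℝ}
    (h : ((t : ℝ) : AddCircle (2 * Real.pi)) = ((t' : ℝ) : AddCircle (2 * Real.pi))) :
    tentCircle K t = tentCircle K t' := by
  rw [tentCircle, tentCircle, h]

/-- `0 ≤ g_K`. [folklore] -/
theorem tentCircle_nonneg (K : ℕ) (t : ℝ) : 0 ≤ tentCircle K t := tent_nonneg _

/-- **Wrap-around lemma**: for `K ≥ 2` and `|y| ≤ 2π - 2π/K`, the planar tent of half-width `2π/K`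
at `y` agrees with the periodic one: `Λ(K y/(2π)) = g_K(y)`. [folklore] -/
theorem tent_eq_tentCircle {K : ℕ} (hK : 2 ≤ K) {y : ℝ}
    (hy : |y| ≤ 2 * Real.pi - 2 * Real.pi / K) : tent (K * y / (2 * Real.pi)) = tentCircle K y := by
  have hπ := Real.pi_pos
  have hK0 : (0 : ℝ) < K := by exact_mod_cast (by omega : 0 < K)
  have hK2 : (2 : ℝ) ≤ K := by exact_mod_cast hK
  -- reduce to `y ≥ 0` by evenness
  wlog hy0 : 0 ≤ y generalizing y
  · have h := this (y := -y) (by rwa [abs_neg]) (by linarith [le_of_not_ge hy0])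
    rw [mul_neg, neg_div, tent_neg] at h
    rw [h, tentCircle, tentCircle, ← norm_neg, ← QuotientAddGroup.mk_neg, neg_neg]
  rw [abs_of_nonneg hy0] at hy
  rw [tentCircle]
  rcases le_or_gt y Real.pi with h1 | h1
  · -- no wrap: `‖y‖ = |y|`
    rw [(AddCircle.norm_coe_eq_abs_iff (2 * Real.pi) (by positivity)).mpr (by
      rw [abs_of_nonneg hy0, abs_of_pos (by positivity)]; linarith), abs_of_nonneg hy0]
  · -- wrap: `y ∈ (π, 2π - 2π/K]`, `‖y‖ = 2π - y ≥ 2π/K` and both tents vanish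
    have hKdiv : 0 < 2 * Real.pi / K := by positivity
    have hy2 : y - 2 * Real.pi ≤ 0 := by linarith
    have hrep : ((y : ℝ) : AddCircle (2 * Real.pi)) = ((y - 2 * Real.pi : ℝ) : AddCircle (2 * Real.pi)) := by
      rw [← AddCircle.coe_add_period (2 * Real.pi) (y - 2 * Real.pi), sub_add_cancel]
    rw [hrep, (AddCircle.norm_coe_eq_abs_iff (2 * Real.pi) (by positivity)).mpr (by
      rw [abs_of_nonpos hy2, abs_of_pos (by positivity)]; linarith),
      abs_of_nonpos hy2]
    have h3 : (K : ℝ) * y ≤ K * (2 * Real.pi - 2 * Real.pi / K) := mul_le_mul_of_nonneg_left hy hK0.le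
    have h4 : (K : ℝ) * (2 * Real.pi - 2 * Real.pi / K) = 2 * Real.pi * K - 2 * Real.pi := by
      field_simp
    rw [tent_eq_zero, tent_eq_zero]
    · have h5 : 0 ≤ -(y - 2 * Real.pi) := by linarith
      rw [abs_of_nonneg (by positivity), le_div_iff₀ (by positivity)]
      nlinarith
    · rw [abs_of_nonneg (by positivity), le_div_iff₀ (by positivity)]
      nlinarith

/-- The planar tent with vertex `β + 2πj/K`, `1 ≤ j ≤ K - 1`, evaluated at a point of the window
`[β, β + 2π)`, equals the periodic tent `g_K(· - (β + 2πj/K))`. [folklore] -/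
theorem tent_window_eq_tentCircle {K : ℕ} (hK : 2 ≤ K) {j : ℕ} (hj1 : 1 ≤ j) (hjK : j + 1 ≤ K)
    {β φ : ℝ} (hφ1 : β ≤ φ) (hφ2 : φ < β + 2 * Real.pi) :
    tent (K * (φ - β) / (2 * Real.pi) - j) = tentCircle K (φ - (β + 2 * Real.pi * j / K)) := by
  have hπ := Real.pi_pos
  have hK0 : (0 : ℝ) < K := by exact_mod_cast (by omega : 0 < K)
  have hj' : (j : ℝ) + 1 ≤ K := by exact_mod_cast hjK
  have hj1' : (1 : ℝ) ≤ j := by exact_mod_cast hj1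
  rw [← tent_eq_tentCircle hK]
  · congr 1
    field_simp
    ring
  · rw [abs_le]
    constructor
    · -- `φ - β - 2πj/K ≥ -2πj/K ≥ -(2π - 2π/K)`
      have : 2 * Real.pi * j / K ≤ 2 * Real.pi - 2 * Real.pi / K := by
        rw [div_le_iff₀ hK0, sub_mul, div_mul_cancel₀ _ hK0.ne']
        nlinarith
      linarith
    · have : 2 * Real.pi / K ≤ 2 * Real.pi * j / K := by
        rw [div_le_div_iff_of_pos_right hK0]; nlinarith
      linarith

/-- The two half-tents at the ends of the window add up to the periodic tent at `β`: for
`φ ∈ [β, β + 2π)`, `Λ(K(φ-β)/2π) + Λ(K(φ-β)/2π - K) = g_K(φ - β)`. [folklore] -/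
theorem tent_window_ends_eq_tentCircle {K : ℕ} (hK : 2 ≤ K) {β φ : ℝ} (hφ1 : β ≤ φ)
    (hφ2 : φ < β + 2 * Real.pi) :
    tent (K * (φ - β) / (2 * Real.pi)) + tent (K * (φ - β) / (2 * Real.pi) - K) =
      tentCircle K (φ - β) := by
  have hπ := Real.pi_pos
  have hK0 : (0 : ℝ) < K := by exact_mod_cast (by omega : 0 < K)
  have hK2 : (2 : ℝ) ≤ K := by exact_mod_cast hK
  set y := φ - β with hy
  have hy0 : 0 ≤ y := by linarith
  have hy2 : y < 2 * Real.pi := by linarith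
  have hKπ : 2 * Real.pi / K ≤ Real.pi := by
    rw [div_le_iff₀ hK0]; nlinarith
  rcases le_or_gt y Real.pi with h1 | h1
  · -- `y ≤ π`: second tent vanishes, first is the periodic one
    have hA : K * y / (2 * Real.pi) ≤ K / 2 := by
      rw [div_le_iff₀ (by positivity)]
      nlinarith [mul_le_mul_of_nonneg_left h1 hK0.le]
    rw [tent_eq_zero (u := K * y / (2 * Real.pi) - K), add_zero, tent_eq_tentCircle hK]
    · rw [abs_of_nonneg hy0]
      linarith
    · rw [abs_of_nonpos (by linarith)]
      linarith
  · -- `y > π`: first tent vanishes, second is the periodic one at `y - 2π`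
    have hrep : tentCircle K y = tentCircle K (y - 2 * Real.pi) :=
      tentCircle_eq_of_coe_eq K (by
        rw [← AddCircle.coe_add_period (2 * Real.pi) (y - 2 * Real.pi), sub_add_cancel])
    rw [tent_eq_zero (u := K * y / (2 * Real.pi)), zero_add, hrep, ← tent_eq_tentCircle hK]
    · congr 1
      field_simp
    · rw [abs_of_nonpos (by linarith)]
      linarith
    · rw [abs_of_nonneg (by positivity), le_div_iff₀ (by positivity)]
      nlinarith [mul_le_mul_of_nonneg_right hK2 hy0]

/-- **Partition of unity by the rotated periodic tents**:
`∑_{j=0}^{K-1} g_K(t - β - 2πj/K) = 1` for all real `t` (`K ≥ 2`). [folklore] -/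
theorem sum_tentCircle_eq_one {K : ℕ} (hK : 2 ≤ K) (β t : ℝ) :
    ∑ j ∈ range K, tentCircle K (t - (β + 2 * Real.pi * j / K)) = 1 := by
  have hπ := Real.pi_pos
  have hK0 : (0 : ℝ) < K := by exact_mod_cast (by omega : 0 < K)
  -- pass to the representative `φ ∈ [β, β + 2π)` of `t`
  set φ := toIcoMod Real.two_pi_pos β t with hφ
  have hφ1 : β ≤ φ := (toIcoMod_mem_Ico Real.two_pi_pos β t).1
  have hφ2 : φ < β + 2 * Real.pi := (toIcoMod_mem_Ico Real.two_pi_pos β t).2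
  have hcoe : ∀ c : ℝ, ((t - c : ℝ) : AddCircle (2 * Real.pi)) = ((φ - c : ℝ) : AddCircle (2 * Real.pi)) := by
    intro c
    rw [QuotientAddGroup.eq_iff_sub_mem, AddSubgroup.mem_zmultiples_iff]
    refine ⟨toIcoDiv Real.two_pi_pos β t, ?_⟩
    rw [hφ, toIcoMod]
    simp only [zsmul_eq_mul]
    ring
  have hrw : ∀ j ∈ range K, tentCircle K (t - (β + 2 * Real.pi * j / K)) =
      tentCircle K (φ - (β + 2 * Real.pi * j / K)) := fun j _ ↦ tentCircle_eq_of_coe_eq K (hcoe _)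
  rw [sum_congr rfl hrw]
  -- planar partition of unity on the window, regrouped
  have hu0 : 0 ≤ K * (φ - β) / (2 * Real.pi) := by positivity
  have huK : K * (φ - β) / (2 * Real.pi) ≤ K := by
    rw [div_le_iff₀ (by positivity)]; nlinarith
  have hplanar := sum_tent_sub_eq_one hu0 huK
  obtain ⟨k, rfl⟩ : ∃ k, K = k + 2 := ⟨K - 2, by omega⟩
  rw [sum_range_succ, sum_range_succ'] at hplanar
  rw [sum_range_succ']
  have hmid : ∀ j ∈ range (k + 1),
      tentCircle (k + 2) (φ - (β + 2 * Real.pi * ((j + 1 : ℕ) : ℝ) / ((k + 2 : ℕ) : ℝ))) =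
        tent (((k + 2 : ℕ) : ℝ) * (φ - β) / (2 * Real.pi) - ((j + 1 : ℕ) : ℝ)) := by
    intro j hj
    have hj := mem_range.mp hj
    rw [tent_window_eq_tentCircle hK (by omega) (by omega) hφ1 hφ2]
  have hends : tentCircle (k + 2) (φ - (β + 2 * Real.pi * ((0 : ℕ) : ℝ) / ((k + 2 : ℕ) : ℝ))) =
      tent (((k + 2 : ℕ) : ℝ) * (φ - β) / (2 * Real.pi) - ((0 : ℕ) : ℝ)) +
        tent (((k + 2 : ℕ) : ℝ) * (φ - β) / (2 * Real.pi) - ((k + 2 : ℕ) : ℝ)) := by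
    rw [Nat.cast_zero, mul_zero, zero_div, add_zero, sub_zero,
      tent_window_ends_eq_tentCircle hK hφ1 hφ2]
  rw [sum_congr rfl hmid, hends]
  linarith

/-! ### 3'. All rotated tents have asymptotic average `1/K` -/

/-- Averages over `S_N` of a real function of the angle. [folklore] -/
def avg (S : Finset X) (ω : X → ℝ) (f : ℝ → ℝ) : ℝ := (∑ x ∈ S, f (ω x)) / S.card

/-- `avg` is monotone in `f`. [folklore] -/
theorem avg_mono (S : Finset X) (ω : X → ℝ) {f g : ℝ → ℝ} (h : ∀ t, f t ≤ g t) :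
    avg S ω f ≤ avg S ω g := by
  unfold avg
  rcases eq_or_ne S.card 0 with hc | hc
  · simp [hc]
  · exact div_le_div_of_nonneg_right (sum_le_sum fun x _ ↦ h _) (by positivity)

/-- `avg` of a finite sum of functions. [folklore] -/
theorem avg_sum (S : Finset X) (ω : X → ℝ) {ι : Type*} (s : Finset ι) (f : ι → ℝ → ℝ) :
    avg S ω (fun t ↦ ∑ i ∈ s, f i t) = ∑ i ∈ s, avg S ω (f i) := by
  unfold avg
  rw [sum_comm, sum_div]

/-- `avg` of the constant `1` is `1` once `S ≠ ∅`. [folklore] -/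
theorem avg_one (S : Finset X) (ω : X → ℝ) (hS : S.card ≠ 0) : avg S ω (fun _ ↦ 1) = 1 := by
  unfold avg
  rw [sum_const, nsmul_eq_mul, mul_one, div_self (by exact_mod_cast hS)]

/-- **Asymptotic averages of the periodic tent, up to `ε`**: for every `ε > 0` there is a number
`γ` (the constant term of an `ε`-close trigonometric polynomial) such that for every shift `c`,
eventually `|avg_N g_K(· - c) - γ| ≤ 2ε`. [folklore] -/
theorem exists_forall_eventually_avg_tentCircle (S : ℕ → Finset X) (ω : X → ℝ)
    (h0 : Tendsto (fun N ↦ (S N).card) atTop atTop)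
    (hW : ∀ k : ℤ, k ≠ 0 →
      (fun N ↦ ∑ x ∈ S N, cexp (k * ω x * I)) =o[atTop] fun N ↦ ((S N).card : ℝ))
    (K : ℕ) {ε : ℝ} (hε : 0 < ε) :
    ∃ γ : ℝ, ∀ c : ℝ, ∀ᶠ N in atTop, |avg (S N) ω (fun t ↦ tentCircle K (t - c)) - γ| ≤ 2 * ε := by
  obtain ⟨s, coef, happrox⟩ := exists_trigPoly_approx (tentCircleMap K) hε
  refine ⟨(if (0 : ℤ) ∈ s then coef 0 else 0).re, fun c ↦ ?_⟩
  have hlim := tendsto_avg_trigPoly S ω h0 hW s coef c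
  have hev := Metric.tendsto_nhds.mp hlim ε hε
  filter_upwards [hev, h0.eventually_ge_atTop 1] with N hN hcard
  have hcard0 : ((S N).card : ℝ) ≠ 0 := by exact_mod_cast (by omega : (S N).card ≠ 0)
  rw [dist_eq_norm] at hN
  -- the average of the tent is within `ε` of the (complex) average of the polynomial
  set A : ℂ := (∑ x ∈ S N, ∑ k ∈ s, coef k * cexp (k * (ω x - c) * I)) / (S N).card with hA
  set L : ℂ := if (0 : ℤ) ∈ s then coef 0 else 0 with hL
  have h1 : ‖((avg (S N) ω (fun t ↦ tentCircle K (t - c)) : ℝ) : ℂ) - A‖ ≤ ε := by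
    rw [avg, hA, ofReal_div, ofReal_natCast, ← sub_div, norm_div, Complex.norm_natCast,
      div_le_iff₀ (by positivity), ofReal_sum, ← sum_sub_distrib]
    refine (norm_sum_le _ _).trans ?_
    calc ∑ x ∈ S N, ‖((tentCircle K (ω x - c) : ℝ) : ℂ) - ∑ k ∈ s, coef k * cexp (k * (ω x - c) * I)‖
        ≤ ∑ _x ∈ S N, ε := sum_le_sum fun x _ ↦ by
          rw [← tentCircleMap_coe]; simpa only [ofReal_sub] using happrox (ω x - c)
      _ = ε * (S N).card := by rw [sum_const, nsmul_eq_mul, mul_comm]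
  have h2 : ‖((avg (S N) ω (fun t ↦ tentCircle K (t - c)) : ℝ) : ℂ) - L‖ ≤ 2 * ε := by
    calc ‖((avg (S N) ω (fun t ↦ tentCircle K (t - c)) : ℝ) : ℂ) - L‖
        ≤ ‖((avg (S N) ω (fun t ↦ tentCircle K (t - c)) : ℝ) : ℂ) - A‖ + ‖A - L‖ := norm_sub_le_norm_sub_add_norm_sub _ _ _
      _ ≤ ε + ε := add_le_add h1 hN.le
      _ = 2 * ε := by ring
  calc |avg (S N) ω (fun t ↦ tentCircle K (t - c)) - L.re|
      = |((((avg (S N) ω (fun t ↦ tentCircle K (t - c)) : ℝ) : ℂ) - L).re)| := by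
        rw [sub_re, ofReal_re]
    _ ≤ ‖((avg (S N) ω (fun t ↦ tentCircle K (t - c)) : ℝ) : ℂ) - L‖ := abs_re_le_norm _
    _ ≤ 2 * ε := h2

/-- **Every rotated periodic tent has asymptotic average `1/K`** (`K ≥ 2`): with
`c_j = β + 2πj/K`, `avg_N g_K(· - c_j) → 1/K`. [cite: Weyl1916, §1] -/
theorem tendsto_avg_tentCircle (S : ℕ → Finset X) (ω : X → ℝ)
    (h0 : Tendsto (fun N ↦ (S N).card) atTop atTop)
    (hW : ∀ k : ℤ, k ≠ 0 →
      (fun N ↦ ∑ x ∈ S N, cexp (k * ω x * I)) =o[atTop] fun N ↦ ((S N).card : ℝ))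
    {K : ℕ} (hK : 2 ≤ K) (β : ℝ) {j : ℕ} (hj : j < K) :
    Tendsto (fun N ↦ avg (S N) ω fun t ↦ tentCircle K (t - (β + 2 * Real.pi * j / K))) atTop
      (𝓝 (1 / K)) := by
  have hK0 : (0 : ℝ) < K := by exact_mod_cast (by omega : 0 < K)
  rw [Metric.tendsto_nhds]
  intro ε hε
  -- work with `ε' = ε/8`
  obtain ⟨γ, hγ⟩ := exists_forall_eventually_avg_tentCircle S ω h0 hW K (by positivity : 0 < ε / 8)
  -- all `K` rotates at once, plus `#S_N ≥ 1`
  have hall : ∀ᶠ N in atTop, ∀ i ∈ range K,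
      |avg (S N) ω (fun t ↦ tentCircle K (t - (β + 2 * Real.pi * i / K))) - γ| ≤ 2 * (ε / 8) :=
    (eventually_all_finset (range K)).mpr fun i _ ↦ hγ _
  filter_upwards [hall, h0.eventually_ge_atTop 1] with N hN hcard
  -- from the partition of unity: `|1 - K γ| ≤ K ε/4`
  have hsum : ∑ i ∈ range K, avg (S N) ω (fun t ↦ tentCircle K (t - (β + 2 * Real.pi * i / K))) = 1 := by
    rw [← avg_sum]
    have : (fun t ↦ ∑ i ∈ range K, tentCircle K (t - (β + 2 * Real.pi * i / K))) = fun _ ↦ 1 :=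
      funext fun t ↦ sum_tentCircle_eq_one hK β t
    rw [this, avg_one _ _ (by omega)]
  have hKγ : |1 - K * γ| ≤ K * (ε / 4) := by
    have h := abs_sum_le_sum_abs (fun i : ℕ ↦ avg (S N) ω (fun t ↦ tentCircle K (t - (β + 2 * Real.pi * i / K))) - γ)
      (range K)
    rw [sum_sub_distrib, hsum, sum_const, card_range, nsmul_eq_mul] at h
    refine h.trans ?_
    calc ∑ i ∈ range K, |avg (S N) ω (fun t ↦ tentCircle K (t - (β + 2 * Real.pi * i / K))) - γ|
        ≤ ∑ _i ∈ range K, 2 * (ε / 8) := sum_le_sum hN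
      _ = K * (ε / 4) := by rw [sum_const, card_range, nsmul_eq_mul]; ring
  have hγK : |γ - 1 / K| ≤ ε / 4 := by
    rw [show γ - 1 / K = -(1 - K * γ) / K by field_simp; ring, abs_div, abs_neg,
      abs_of_pos hK0, div_le_iff₀ hK0]
    linarith
  have hj' := hN j (mem_range.mpr hj)
  rw [dist_eq_norm, Real.norm_eq_abs]
  calc |avg (S N) ω (fun t ↦ tentCircle K (t - (β + 2 * Real.pi * j / K))) - 1 / K|
      ≤ |avg (S N) ω (fun t ↦ tentCircle K (t - (β + 2 * Real.pi * j / K))) - γ| + |γ - 1 / K| :=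
        abs_sub_le _ _ _
    _ ≤ 2 * (ε / 8) + ε / 4 := add_le_add hj' hγK
    _ < ε := by linarith

/-! ### 4. The sandwich and the theorem -/

/-- Periodicity: `g_K(toIcoMod β t - c) = g_K(t - c)`. [folklore] -/
theorem tentCircle_toIcoMod_sub (K : ℕ) (β t c : ℝ) :
    tentCircle K (toIcoMod Real.two_pi_pos β t - c) = tentCircle K (t - c) := by
  refine tentCircle_eq_of_coe_eq K ?_
  rw [QuotientAddGroup.eq_iff_sub_mem, AddSubgroup.mem_zmultiples_iff]
  refine ⟨-toIcoDiv Real.two_pi_pos β t, ?_⟩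
  rw [toIcoMod]
  simp only [zsmul_eq_mul, Int.cast_neg]
  ring

/-- The planar tents on the window `[β, β + 2π)`: `T_j(t) = Λ(K(φ - β)/2π - j)`, `φ = t mod 2π ∈ [β, β+2π)`.
[folklore] -/
def tentWindow (K : ℕ) (β : ℝ) (j : ℕ) (t : ℝ) : ℝ :=
  tent (K * (toIcoMod Real.two_pi_pos β t - β) / (2 * Real.pi) - j)

/-- `T_j ≥ 0`. [folklore] -/
theorem tentWindow_nonneg (K : ℕ) (β : ℝ) (j : ℕ) (t : ℝ) : 0 ≤ tentWindow K β j t := tent_nonneg _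

/-- Interior window tents are rotated periodic tents: `T_j(t) = g_K(t - (β + 2πj/K))` for
`1 ≤ j ≤ K - 1`. [folklore] -/
theorem tentWindow_eq_tentCircle {K : ℕ} (hK : 2 ≤ K) (β : ℝ) {j : ℕ} (hj1 : 1 ≤ j) (hjK : j + 1 ≤ K)
    (t : ℝ) : tentWindow K β j t = tentCircle K (t - (β + 2 * Real.pi * j / K)) := by
  rw [tentWindow, tent_window_eq_tentCircle hK hj1 hjK (toIcoMod_mem_Ico Real.two_pi_pos β t).1
    (toIcoMod_mem_Ico Real.two_pi_pos β t).2, tentCircle_toIcoMod_sub]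

/-- The two end tents add up to the periodic tent at `β`: `T_0 + T_K = g_K(· - β)`. [folklore] -/
theorem tentWindow_ends (K : ℕ) (hK : 2 ≤ K) (β t : ℝ) :
    tentWindow K β 0 t + tentWindow K β K t = tentCircle K (t - (β + 2 * Real.pi * (0 : ℕ) / K)) := by
  rw [tentWindow, tentWindow, Nat.cast_zero, sub_zero, mul_zero, zero_div, add_zero,
    tent_window_ends_eq_tentCircle hK (toIcoMod_mem_Ico Real.two_pi_pos β t).1
      (toIcoMod_mem_Ico Real.two_pi_pos β t).2, tentCircle_toIcoMod_sub]

/-- The window tents sum to `1`: `∑_{j=0}^{K} T_j = 1`. [folklore] -/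
theorem sum_tentWindow_eq_one (K : ℕ) (β t : ℝ) : ∑ j ∈ range (K + 1), tentWindow K β j t = 1 := by
  have h1 := (toIcoMod_mem_Ico Real.two_pi_pos β t).1
  have h2 := (toIcoMod_mem_Ico Real.two_pi_pos β t).2
  refine sum_tent_sub_eq_one (by positivity) ?_
  rw [div_le_iff₀ (by positivity)]
  nlinarith [Nat.cast_nonneg (α := ℝ) K]

/-- Regrouping `∑_{j=0}^{K} f(j) = f(0) + f(K) + ∑_{1 ≤ j < K} f(j)` (`K ≥ 1`). [folklore] -/
theorem sum_range_succ_eq_ends_add_Ico {K : ℕ} (hK : 1 ≤ K) (f : ℕ → ℝ) :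
    ∑ j ∈ range (K + 1), f j = f 0 + f K + ∑ j ∈ Ico 1 K, f j := by
  rw [sum_range_succ, Finset.range_eq_Ico, Finset.sum_eq_sum_Ico_succ_bot (by omega)]
  ring

/-- **Lower sandwich**: the tents `T_j`, `1 ≤ j ≤ M = ⌊αK/2π⌋ - 1`, sit inside the arc:
`∑_{j ∈ L} T_j ≤ 𝟙[φ < β + α]`, `L = {1 ≤ j < K : j ≤ M}`. [folklore] -/
theorem sum_tentWindow_le_indicator {K : ℕ} (β : ℝ) {α : ℝ} (hα : 0 ≤ α) (t : ℝ) :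
    ∑ j ∈ (Ico 1 K).filter (fun j ↦ j ≤ ⌊α * K / (2 * Real.pi)⌋₊ - 1), tentWindow K β j t ≤
      if toIcoMod Real.two_pi_pos β t < β + α then 1 else 0 := by
  set φ := toIcoMod Real.two_pi_pos β t with hφ
  set c : ℝ := α * K / (2 * Real.pi) with hc
  have hc0 : 0 ≤ c := by positivity
  split_ifs with h
  · calc ∑ j ∈ (Ico 1 K).filter (fun j ↦ j ≤ ⌊c⌋₊ - 1), tentWindow K β j t
        ≤ ∑ j ∈ range (K + 1), tentWindow K β j t :=
          sum_le_sum_of_subset_of_nonneg (fun j hj ↦ by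
            have := (mem_Ico.mp (mem_filter.mp hj).1).2
            exact mem_range.mpr (by omega)) fun j _ _ ↦ tentWindow_nonneg K β j t
      _ = 1 := sum_tentWindow_eq_one K β t
  · refine le_of_eq (sum_eq_zero fun j hj ↦ ?_)
    obtain ⟨hjI, hjM⟩ := mem_filter.mp hj
    have hj1 : 1 ≤ j := (mem_Ico.mp hjI).1
    -- `u = K(φ-β)/2π ≥ c ≥ ⌊c⌋₊ ≥ j + 1`
    have hφα : β + α ≤ φ := le_of_not_gt h
    have hu : c ≤ K * (φ - β) / (2 * Real.pi) := by
      rw [hc, div_le_div_iff_of_pos_right (by positivity)]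
      nlinarith [Nat.cast_nonneg (α := ℝ) K]
    have hfl : (⌊c⌋₊ : ℝ) ≤ c := Nat.floor_le hc0
    have hjc : (j : ℝ) + 1 ≤ ⌊c⌋₊ := by
      have : j + 1 ≤ ⌊c⌋₊ := by omega
      exact_mod_cast this
    apply tent_eq_zero
    rw [abs_of_nonneg (by linarith)]
    linarith

/-- **Upper sandwich**: `𝟙[φ < β + α] ≤ ∑_{j ∈ U} T_j + (T_0 + T_K)`, `U = {1 ≤ j < K : j ≤ ⌊αK/2π⌋ + 1}`.
[folklore] -/
theorem indicator_le_sum_tentWindow {K : ℕ} (hK : 2 ≤ K) (β : ℝ) {α : ℝ} (hα : 0 ≤ α) (t : ℝ) :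
    (if toIcoMod Real.two_pi_pos β t < β + α then (1 : ℝ) else 0) ≤
      ∑ j ∈ (Ico 1 K).filter (fun j ↦ j ≤ ⌊α * K / (2 * Real.pi)⌋₊ + 1), tentWindow K β j t +
        (tentWindow K β 0 t + tentWindow K β K t) := by
  set φ := toIcoMod Real.two_pi_pos β t with hφ
  set c : ℝ := α * K / (2 * Real.pi) with hc
  have hc0 : 0 ≤ c := by positivity
  have hφ1 : β ≤ φ := (toIcoMod_mem_Ico Real.two_pi_pos β t).1
  split_ifs with h
  · -- all tents `T_j`, `j ∈ [1, K) ∖ U`, vanish at `t`, so the right side is the full sum `= 1`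
    have hvan : ∀ j ∈ Ico 1 K, j ∉ (Ico 1 K).filter (fun j ↦ j ≤ ⌊c⌋₊ + 1) → tentWindow K β j t = 0 := by
      intro j hjI hjU
      have hjM : ⌊c⌋₊ + 2 ≤ j := by
        have := mt (fun h' ↦ mem_filter.mpr ⟨hjI, h'⟩) hjU
        omega
      have hu : K * (φ - β) / (2 * Real.pi) < c := by
        rw [hc, div_lt_div_iff_of_pos_right (by positivity)]
        have hK0 : (0 : ℝ) < K := by exact_mod_cast (by omega : 0 < K)
        nlinarith
      have hfl : c < ⌊c⌋₊ + 1 := Nat.lt_floor_add_one c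
      have hjc : (⌊c⌋₊ : ℝ) + 2 ≤ j := by exact_mod_cast hjM
      apply tent_eq_zero
      rw [abs_of_nonpos (by linarith)]
      linarith
    rw [sum_subset (filter_subset _ _) hvan]
    have := sum_range_succ_eq_ends_add_Ico (by omega : 1 ≤ K) (fun j ↦ tentWindow K β j t)
    rw [sum_tentWindow_eq_one] at this
    linarith
  · exact add_nonneg (sum_nonneg fun j _ ↦ tentWindow_nonneg K β j t)
      (add_nonneg (tentWindow_nonneg K β 0 t) (tentWindow_nonneg K β K t))

/-- `#L ≥ αK/2π - 2` for the lower index set. [folklore] -/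
theorem card_lower_ge {K : ℕ} (hK : 2 ≤ K) {α : ℝ} (hα : 0 ≤ α) (hα2 : α < 2 * Real.pi) :
    α * K / (2 * Real.pi) - 2 ≤ (((Ico 1 K).filter (fun j ↦ j ≤ ⌊α * K / (2 * Real.pi)⌋₊ - 1)).card : ℝ) := by
  set c : ℝ := α * K / (2 * Real.pi) with hc
  have hc0 : 0 ≤ c := by positivity
  have hcK : c < K := by
    rw [hc, div_lt_iff₀ (by positivity)]
    have hK0 : (0 : ℝ) < K := by exact_mod_cast (by omega : 0 < K)
    nlinarith
  have hflK : ⌊c⌋₊ < K := (Nat.floor_lt hc0).mpr hcK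
  have hsub : Icc 1 (⌊c⌋₊ - 1) ⊆ (Ico 1 K).filter (fun j ↦ j ≤ ⌊c⌋₊ - 1) := by
    intro j hj
    obtain ⟨h1, h2⟩ := mem_Icc.mp hj
    exact mem_filter.mpr ⟨mem_Ico.mpr ⟨h1, by omega⟩, h2⟩
  have hcard := card_le_card hsub
  rw [Nat.card_Icc, Nat.add_sub_cancel] at hcard
  have hfl : c < ⌊c⌋₊ + 1 := Nat.lt_floor_add_one c
  calc c - 2 ≤ ((⌊c⌋₊ - 1 : ℕ) : ℝ) := by
        rcases Nat.eq_zero_or_pos ⌊c⌋₊ with h0 | h0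
        · rw [h0] at hfl ⊢
          norm_num at hfl ⊢
          linarith
        · rw [Nat.cast_sub h0]; push_cast; linarith
    _ ≤ _ := by exact_mod_cast hcard

/-- `#U ≤ αK/2π + 1` for the upper index set. [folklore] -/
theorem card_upper_le (K : ℕ) {α : ℝ} (hα : 0 ≤ α) :
    ((((Ico 1 K).filter (fun j ↦ j ≤ ⌊α * K / (2 * Real.pi)⌋₊ + 1)).card : ℝ)) ≤
      α * K / (2 * Real.pi) + 1 := by
  set c : ℝ := α * K / (2 * Real.pi) with hc
  have hc0 : 0 ≤ c := by positivity
  have hsub : (Ico 1 K).filter (fun j ↦ j ≤ ⌊c⌋₊ + 1) ⊆ Icc 1 (⌊c⌋₊ + 1) := by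
    intro j hj
    obtain ⟨hjI, hjM⟩ := mem_filter.mp hj
    exact mem_Icc.mpr ⟨(mem_Ico.mp hjI).1, hjM⟩
  have hcard := card_le_card hsub
  rw [Nat.card_Icc, Nat.add_sub_cancel] at hcard
  calc ((((Ico 1 K).filter (fun j ↦ j ≤ ⌊c⌋₊ + 1)).card : ℝ)) ≤ ((⌊c⌋₊ + 1 : ℕ) : ℝ) := by exact_mod_cast hcard
    _ ≤ c + 1 := by push_cast; linarith [Nat.floor_le hc0]

/-- **Weyl's criterion for arcs.**  If `#S_N → ∞` and the Weyl sums `∑_{x ∈ S_N} e^{ikω(x)}` are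
`o(#S_N)` for every integer `k ≠ 0`, then for every `β` and `0 < α ≤ 2π` the proportion of points
with `ω(x) mod 2π ∈ [β, β + α)` tends to `α/2π`:
`#{x ∈ S_N : toIcoMod 2π β (ω x) < β + α} / #S_N → α / (2π)`.
(Weyl 1916, §1 Satz 1 and §2.) [cite: Weyl1916, §§1–2] -/
theorem tendsto_card_arc_div (S : ℕ → Finset X) (ω : X → ℝ)
    (h0 : Tendsto (fun N ↦ (S N).card) atTop atTop)
    (hW : ∀ k : ℤ, k ≠ 0 →
      (fun N ↦ ∑ x ∈ S N, cexp (k * ω x * I)) =o[atTop] fun N ↦ ((S N).card : ℝ))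
    (β : ℝ) {α : ℝ} (hα : 0 < α) (hα2 : α ≤ 2 * Real.pi) :
    Tendsto (fun N ↦ (((S N).filter (fun x ↦ toIcoMod Real.two_pi_pos β (ω x) < β + α)).card : ℝ) /
      (S N).card) atTop (𝓝 (α / (2 * Real.pi))) := by
  have hπ := Real.pi_pos
  -- the proportion is the average of the indicator
  have havg : ∀ N, (((S N).filter (fun x ↦ toIcoMod Real.two_pi_pos β (ω x) < β + α)).card : ℝ) /
      (S N).card = avg (S N) ω (fun t ↦ if toIcoMod Real.two_pi_pos β t < β + α then 1 else 0) := by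
    intro N
    rw [avg, Finset.sum_boole]
  simp_rw [havg]
  rcases hα2.eq_or_lt with rfl | hα2
  · -- the full circle: the indicator is identically `1`
    have h1 : (fun t ↦ if toIcoMod Real.two_pi_pos β t < β + 2 * Real.pi then (1 : ℝ) else 0) = fun _ ↦ 1 :=
      funext fun t ↦ if_pos (toIcoMod_lt_right Real.two_pi_pos β t)
    rw [h1, div_self (by positivity)]
    refine tendsto_const_nhds.congr' ?_
    filter_upwards [h0.eventually_ge_atTop 1] with N hN
    exact (avg_one _ _ (by omega)).symm
  rw [Metric.tendsto_nhds]
  intro ε hε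
  -- choose `K ≥ 2` with `2/K ≤ ε/4`
  obtain ⟨K, hK2, hKε⟩ : ∃ K : ℕ, 2 ≤ K ∧ 2 / (K : ℝ) ≤ ε / 4 := by
    obtain ⟨K, hK⟩ := exists_nat_ge (max 2 (8 / ε))
    have hK2 : (2 : ℝ) ≤ K := le_trans (le_max_left _ _) hK
    have hK8 : 8 / ε ≤ K := le_trans (le_max_right _ _) hK
    refine ⟨K, by exact_mod_cast hK2, ?_⟩
    rw [div_le_iff₀ (by linarith)]
    rw [div_le_iff₀ hε] at hK8
    nlinarith
  have hK0 : (0 : ℝ) < K := by exact_mod_cast (by omega : 0 < K)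
  set c : ℝ := α * K / (2 * Real.pi) with hc
  set L := (Ico 1 K).filter (fun j ↦ j ≤ ⌊c⌋₊ - 1) with hL
  set U := (Ico 1 K).filter (fun j ↦ j ≤ ⌊c⌋₊ + 1) with hU
  -- tent averages converge to `1/K`
  have hT : ∀ j ∈ Ico 1 K, Tendsto (fun N ↦ avg (S N) ω (tentWindow K β j)) atTop (𝓝 (1 / K)) := by
    intro j hj
    obtain ⟨hj1, hjK⟩ := mem_Ico.mp hj
    have heq : tentWindow K β j = fun t ↦ tentCircle K (t - (β + 2 * Real.pi * j / K)) :=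
      funext fun t ↦ tentWindow_eq_tentCircle hK2 β hj1 (by omega) t
    rw [heq]
    exact tendsto_avg_tentCircle S ω h0 hW hK2 β hjK
  have hE : Tendsto (fun N ↦ avg (S N) ω (fun t ↦ tentWindow K β 0 t + tentWindow K β K t)) atTop
      (𝓝 (1 / K)) := by
    have heq : (fun t ↦ tentWindow K β 0 t + tentWindow K β K t) =
        fun t ↦ tentCircle K (t - (β + 2 * Real.pi * (0 : ℕ) / K)) := funext fun t ↦ tentWindow_ends K hK2 β t
    rw [heq]
    exact tendsto_avg_tentCircle S ω h0 hW hK2 β (by omega)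
  have hLow : Tendsto (fun N ↦ ∑ j ∈ L, avg (S N) ω (tentWindow K β j)) atTop (𝓝 (∑ _j ∈ L, (1 / K : ℝ))) :=
    tendsto_finsetSum L fun j hj ↦ hT j (mem_filter.mp hj).1
  have hUp : Tendsto (fun N ↦ ∑ j ∈ U, avg (S N) ω (tentWindow K β j) +
      avg (S N) ω (fun t ↦ tentWindow K β 0 t + tentWindow K β K t)) atTop
      (𝓝 (∑ _j ∈ U, (1 / K : ℝ) + 1 / K)) :=
    (tendsto_finsetSum U fun j hj ↦ hT j (mem_filter.mp hj).1).add hE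
  rw [sum_const, nsmul_eq_mul] at hLow hUp
  have hLcard := card_lower_ge hK2 hα.le hα2
  have hUcard := card_upper_le K hα.le
  have hε4 : 0 < ε / 4 := by linarith
  filter_upwards [(Metric.tendsto_nhds.mp hLow) (ε / 4) hε4, (Metric.tendsto_nhds.mp hUp) (ε / 4) hε4]
    with N hN1 hN2
  rw [dist_eq_norm, Real.norm_eq_abs] at hN1 hN2 ⊢
  -- the sandwich at time `N`
  have hlow : ∑ j ∈ L, avg (S N) ω (tentWindow K β j) ≤
      avg (S N) ω (fun t ↦ if toIcoMod Real.two_pi_pos β t < β + α then 1 else 0) := by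
    rw [← avg_sum]
    exact avg_mono _ _ fun t ↦ sum_tentWindow_le_indicator β hα.le t
  have hup : avg (S N) ω (fun t ↦ if toIcoMod Real.two_pi_pos β t < β + α then 1 else 0) ≤
      ∑ j ∈ U, avg (S N) ω (tentWindow K β j) +
        avg (S N) ω (fun t ↦ tentWindow K β 0 t + tentWindow K β K t) := by
    rw [← avg_sum]
    have : ∀ N, avg (S N) ω (fun t ↦ ∑ i ∈ U, tentWindow K β i t) +
        avg (S N) ω (fun t ↦ tentWindow K β 0 t + tentWindow K β K t) =
        avg (S N) ω (fun t ↦ ∑ i ∈ U, tentWindow K β i t + (tentWindow K β 0 t + tentWindow K β K t)) := by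
      intro N
      unfold avg
      rw [← add_div, ← sum_add_distrib]
    rw [this]
    exact avg_mono _ _ fun t ↦ indicator_le_sum_tentWindow hK2 β hα.le t
  -- numerology: `#L/K ≥ α/2π - 2/K`, `(#U+1)/K ≤ α/2π + 2/K`
  have h1 : α / (2 * Real.pi) - 2 / K ≤ (L.card : ℝ) * (1 / K) := by
    rw [show α / (2 * Real.pi) - 2 / K = (c - 2) * (1 / K) by rw [hc]; field_simp]
    exact mul_le_mul_of_nonneg_right hLcard (by positivity)
  have h2 : (U.card : ℝ) * (1 / K) + 1 / K ≤ α / (2 * Real.pi) + 2 / K := by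
    rw [show α / (2 * Real.pi) + 2 / K = (c + 1 + 1) * (1 / K) by rw [hc]; field_simp; ring,
      show (U.card : ℝ) * (1 / K) + 1 / K = (U.card + 1) * (1 / K) by ring]
    exact mul_le_mul_of_nonneg_right (by linarith) (by positivity)
  rw [abs_lt]
  constructor <;> nlinarith [abs_le.mp hN1.le, abs_le.mp hN2.le]

end WeylCircle

end Literature.NumberTheory.DiophantineApproximation
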